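import Mathlib
import HarnessLib

/-!
# The quadratic Combes–Thomas bound: exponential decay of `(AᴴA + μ)⁻¹` for a finite-range `A`

Topic `Literature/Analysis/Matrix`; namespace `Literature.Analysis.Matrix`.  Everything here is
PROVED (no definitions, no named facts).

Let `ι` be a finite index set with an `ℕ`-valued pseudo-metric `dist`, and `A : Matrix ι ι ℂ` of
RANGE ONE (`A i j ≠ 0 → dist i j ≤ 1`) whose absolute row and column sums over `{j | dist i j ≠ 0}`
are at most `h`.  For real `μ`, `θ ≥ 0`, `γ > 0` and a floor `F` with `F Σ|v_i|² ≤ Σ|(Av)_i|²`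
for all `v`, put `η := h (e^θ − 1)`.  If `t² − 2ηt − η² + μ ≥ γ` for every `t ≥ √F`, then
`AᴴA + μ` is invertible and `|(AᴴA + μ)⁻¹ᵢⱼ| ≤ γ⁻¹ e^{−θ dist(i,j)}` (`quadratic_combes_thomas`).
No spectral information on `A` beyond the floor is used and nothing depends on `|ι|`: this is the
"quadratic" Combes–Thomas estimate behind the locality of `(DᴴD + λ)⁻¹` for lattice Dirac
operators `D` uniformly in the gauge field (`F = 0`, `μ = λ > 0`, `η = √λ/2`, `γ = λ/2`) and behind
the Agmon decay of sub-threshold eigenvectors (`F > 0`, `μ = −e`).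

Proof ([CombesThomas1973]; [AizenmanWarzel2015, §10.3], sandwich form): fix the column `j₀`, put
`ρ_i := dist(i,j₀)`, `W := diag(e^{θρ_i})`.  Then `W (AᴴA + μ) W⁻¹ = (A + E₋)ᴴ (A + E₊) + μ` with
`(E_±)_{lk} = A_{lk} (e^{±θ(ρ_l − ρ_k)} − 1)`; as `|ρ_l − ρ_k| ≤ dist(l,k) ≤ 1` on the support of
`A`, these entries vanish where `dist(l,k) = 0` and are at most `|A_{lk}| (e^θ − 1)` elsewhere, so
Schur's test ([HornJohnson2013, §5.6]; `sum_norm_sq_mulVec_le_of_rowSum_le_of_colSum_le`) gives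
`‖E_± v‖ ≤ η‖v‖`, whence `Re⟨v, W(AᴴA + μ)W⁻¹ v⟩ ≥ ‖Av‖² − 2η‖Av‖‖v‖ − η²‖v‖² + μ‖v‖² ≥ γ‖v‖²`
(`quadraticCombesThomas_weighted_coercive`, stated without `W` as a weighted coercivity of
`AᴴA + μ` itself).  A `γ`-accretive matrix is invertible with inverse bounded by `γ⁻¹`, and undoing
the conjugation on the column `j₀` (`ρ_{j₀} = 0`) gives the decay.
-/

noncomputable section

open Finset
open scoped Matrix ComplexConjugate

namespace Literature.Analysis.Matrix

/-! ### Schur's test in quadratic-form language -/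

section Schur

variable {ι κ : Type*} [Fintype ι] [Fintype κ]

/-- **Schur's test** (Horn–Johnson §5.6) as a finite-sum inequality: if every absolute row sum of
`E` is at most `R ≥ 0` and every absolute column sum at most `C`, then
`Σ_i |(E v)_i|² ≤ R C Σ_k |v_k|²`, i.e. `‖E‖ ≤ √(RC)`. [folklore] -/
theorem sum_norm_sq_mulVec_le_of_rowSum_le_of_colSum_le (E : Matrix ι κ ℂ) {R C : ℝ}
    (hR : 0 ≤ R) (hrow : ∀ i, ∑ k, ‖E i k‖ ≤ R) (hcol : ∀ k, ∑ i, ‖E i k‖ ≤ C) (v : κ → ℂ) :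
    ∑ i, ‖(E *ᵥ v) i‖ ^ 2 ≤ R * C * ∑ k, ‖v k‖ ^ 2 := by
  have hpt : ∀ i, ‖(E *ᵥ v) i‖ ^ 2 ≤ R * ∑ k, ‖E i k‖ * ‖v k‖ ^ 2 := by
    intro i
    have h1 : ‖(E *ᵥ v) i‖ ≤ ∑ k, ‖E i k‖ * ‖v k‖ := by
      simp only [Matrix.mulVec, dotProduct]
      exact (norm_sum_le _ _).trans (le_of_eq (Finset.sum_congr rfl fun k _ => norm_mul _ _))
    have h2 : (∑ k, ‖E i k‖ * ‖v k‖) ^ 2 ≤ (∑ k, ‖E i k‖) * ∑ k, ‖E i k‖ * ‖v k‖ ^ 2 :=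
      Finset.sum_sq_le_sum_mul_sum_of_sq_le_mul _ (fun k _ => norm_nonneg _)
        (fun k _ => mul_nonneg (norm_nonneg _) (sq_nonneg _)) (fun k _ => le_of_eq (by ring))
    have h0 : 0 ≤ ∑ k, ‖E i k‖ * ‖v k‖ ^ 2 := Finset.sum_nonneg fun k _ => by positivity
    calc ‖(E *ᵥ v) i‖ ^ 2 ≤ (∑ k, ‖E i k‖ * ‖v k‖) ^ 2 :=
          pow_le_pow_left₀ (norm_nonneg _) h1 2
      _ ≤ (∑ k, ‖E i k‖) * ∑ k, ‖E i k‖ * ‖v k‖ ^ 2 := h2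
      _ ≤ R * ∑ k, ‖E i k‖ * ‖v k‖ ^ 2 := mul_le_mul_of_nonneg_right (hrow i) h0
  calc ∑ i, ‖(E *ᵥ v) i‖ ^ 2 ≤ ∑ i, R * ∑ k, ‖E i k‖ * ‖v k‖ ^ 2 :=
        Finset.sum_le_sum fun i _ => hpt i
    _ = R * ∑ k, (∑ i, ‖E i k‖) * ‖v k‖ ^ 2 := by
        rw [← Finset.mul_sum, Finset.sum_comm]
        refine congrArg _ (Finset.sum_congr rfl fun k _ => ?_)
        rw [Finset.sum_mul]
    _ ≤ R * ∑ k, C * ‖v k‖ ^ 2 := by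
        refine mul_le_mul_of_nonneg_left (Finset.sum_le_sum fun k _ => ?_) hR
        exact mul_le_mul_of_nonneg_right (hcol k) (sq_nonneg _)
    _ = R * C * ∑ k, ‖v k‖ ^ 2 := by rw [← Finset.mul_sum, mul_assoc]

/-- **Cauchy–Schwarz** for the complex dot product against sums of squared moduli:
`|u⋆ · w| ≤ (Σ|u_i|²)^{1/2} (Σ|w_i|²)^{1/2}`. [folklore] -/
theorem norm_star_dotProduct_le_sqrt_mul_sqrt (u w : ι → ℂ) :
    ‖star u ⬝ᵥ w‖ ≤ Real.sqrt (∑ i, ‖u i‖ ^ 2) * Real.sqrt (∑ i, ‖w i‖ ^ 2) := by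
  calc ‖star u ⬝ᵥ w‖ ≤ ∑ i, ‖star (u i) * w i‖ := norm_sum_le _ _
    _ = ∑ i, ‖u i‖ * ‖w i‖ := Finset.sum_congr rfl fun i _ => by rw [norm_mul, norm_star]
    _ ≤ _ := Real.sum_mul_le_sqrt_mul_sqrt _ _ _

end Schur

/-! ### Two scalar estimates -/

/-- For `θ ≥ 0` and `|s| ≤ 1`: `|e^{θs} − 1| ≤ e^θ − 1` (from `1 + x ≤ eˣ`). [folklore] -/
theorem abs_exp_mul_sub_one_le {θ s : ℝ} (hθ : 0 ≤ θ) (hs : |s| ≤ 1) :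
    |Real.exp (θ * s) - 1| ≤ Real.exp θ - 1 := by
  rw [abs_le] at hs ⊢
  have h1 := Real.add_one_le_exp (θ * s)
  have h2 := Real.add_one_le_exp θ
  have h3 : -θ ≤ θ * s := by nlinarith
  have h4 : θ * s ≤ θ := by nlinarith
  have h5 := Real.exp_le_exp.mpr h4
  constructor <;> linarith

/-- The distance to a fixed point is `1`-Lipschitz for a symmetric `ℕ`-valued `dist` satisfying
the triangle inequality: `|dist(l,j₀) − dist(k,j₀)| ≤ dist(l,k)`. [folklore] -/
theorem abs_natDist_sub_natDist_le {ι : Type*} (dist : ι → ι → ℕ)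
    (hds : ∀ i j, dist i j = dist j i) (hdt : ∀ i j k, dist i k ≤ dist i j + dist j k)
    (l k j₀ : ι) : |(dist l j₀ : ℝ) - dist k j₀| ≤ dist l k := by
  have h1 : (dist l j₀ : ℝ) ≤ dist l k + dist k j₀ := by exact_mod_cast hdt l k j₀
  have h2 : (dist k j₀ : ℝ) ≤ dist l k + dist l j₀ := by
    have := hdt k l j₀
    rw [hds k l] at this
    exact_mod_cast this
  rw [abs_le]
  constructor <;> linarith

/-! ### The conjugated perturbation and the weighted coercivity -/

section CombesThomas

variable {ι : Type*} [Fintype ι] [DecidableEq ι]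

omit [Fintype ι] [DecidableEq ι] in
/-- Entries of the Combes–Thomas perturbation `E_{lk} = A_{lk}(e^{θs} − 1)`, `|s| ≤ dist(l,k)`,
for a range-one matrix `A`: they vanish where `dist(l,k) = 0` and are bounded by
`(e^θ − 1)|A_{lk}|` elsewhere. [folklore] -/
theorem norm_mul_exp_sub_one_le (dist : ι → ι → ℕ) (A : Matrix ι ι ℂ)
    (hrange : ∀ i j, A i j ≠ 0 → dist i j ≤ 1) {θ : ℝ} (hθ : 0 ≤ θ) (l k : ι) {s : ℝ}
    (hs : |s| ≤ dist l k) :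
    ‖A l k * ((Real.exp (θ * s) - 1 : ℝ) : ℂ)‖ ≤
      (Real.exp θ - 1) * (if dist l k ≠ 0 then ‖A l k‖ else 0) := by
  rw [norm_mul, Complex.norm_real, Real.norm_eq_abs]
  by_cases hlk : dist l k = 0
  · have hs0 : s = 0 := by
      rw [hlk, Nat.cast_zero] at hs
      exact abs_nonpos_iff.mp hs
    simp [hs0, hlk]
  · rw [if_pos hlk]
    by_cases hA : A l k = 0
    · simp [hA]
    · have h1 : (dist l k : ℝ) ≤ 1 := by exact_mod_cast hrange l k hA
      rw [mul_comm]
      exact mul_le_mul_of_nonneg_right (abs_exp_mul_sub_one_le hθ (hs.trans h1)) (norm_nonneg _)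

/-- **Weighted coercivity of `AᴴA + μ`** (the Combes–Thomas conjugation, unfolded).  Under the
hypotheses of `quadratic_combes_thomas` (range one, off-diagonal row/column sums `≤ h`, floor
`F`, and `t² − 2ηt − η² + μ ≥ γ` for `t ≥ √F`, `η = h(e^θ − 1)`), for every column index `j₀`
and every `x`, with the weights `d_k = e^{θ dist(k,j₀)}`:
`γ Σ_k d_k² |x_k|² ≤ Re Σ_k d_k² conj(x_k) ((AᴴA + μ) x)_k`.
(With `v = d·x` the right side is `Re⟨(A + E₋)v, (A + E₊)v⟩ + μ‖v‖²`.) [folklore] -/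
theorem quadraticCombesThomas_weighted_coercive (dist : ι → ι → ℕ)
    (hds : ∀ i j, dist i j = dist j i) (hdt : ∀ i j k, dist i k ≤ dist i j + dist j k)
    (A : Matrix ι ι ℂ) (hrange : ∀ i j, A i j ≠ 0 → dist i j ≤ 1) (h : ℝ)
    (hrow : ∀ i, ∑ j ∈ univ.filter (fun j => dist i j ≠ 0), ‖A i j‖ ≤ h)
    (hcol : ∀ j, ∑ i ∈ univ.filter (fun i => dist i j ≠ 0), ‖A i j‖ ≤ h)
    (F μ θ γ : ℝ) (hθ : 0 ≤ θ)
    (hfloor : ∀ v : ι → ℂ, F * ∑ i, ‖v i‖ ^ 2 ≤ ∑ i, ‖(A *ᵥ v) i‖ ^ 2)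
    (hcoer : ∀ t : ℝ, Real.sqrt F ≤ t →
      γ ≤ t ^ 2 - 2 * (h * (Real.exp θ - 1)) * t - (h * (Real.exp θ - 1)) ^ 2 + μ)
    (j₀ : ι) (x : ι → ℂ) :
    γ * ∑ k, Real.exp (θ * dist k j₀) ^ 2 * ‖x k‖ ^ 2 ≤
      (star (fun k => ((Real.exp (θ * dist k j₀) ^ 2 : ℝ) : ℂ) * x k) ⬝ᵥ
        ((Aᴴ * A + (μ : ℂ) • (1 : Matrix ι ι ℂ)) *ᵥ x)).re := by
  -- the weights, the weighted vectors and the perturbations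
  set η : ℝ := h * (Real.exp θ - 1) with hη
  set d : ι → ℝ := fun k => Real.exp (θ * dist k j₀) with hd
  set v : ι → ℂ := fun k => (d k : ℂ) * x k with hv
  set y : ι → ℂ := fun k => ((d k ^ 2 : ℝ) : ℂ) * x k with hy
  set Ep : Matrix ι ι ℂ := Matrix.of fun l k =>
    A l k * ((Real.exp (θ * ((dist l j₀ : ℝ) - dist k j₀)) - 1 : ℝ) : ℂ) with hEp
  set Em : Matrix ι ι ℂ := Matrix.of fun l k =>
    A l k * ((Real.exp (θ * ((dist k j₀ : ℝ) - dist l j₀)) - 1 : ℝ) : ℂ) with hEm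
  set a : ι → ℂ := A *ᵥ v with ha
  set ep : ι → ℂ := Ep *ᵥ v with hep
  set em : ι → ℂ := Em *ᵥ v with hem
  set S : ℝ := ∑ k, ‖v k‖ ^ 2 with hS
  have hexp0 : 0 ≤ Real.exp θ - 1 := by linarith [Real.add_one_le_exp θ]
  have hh0 : 0 ≤ h := (Finset.sum_nonneg fun j _ => norm_nonneg _).trans (hrow j₀)
  have hη0 : 0 ≤ η := mul_nonneg hh0 hexp0
  have hS0 : 0 ≤ S := Finset.sum_nonneg fun k _ => by positivity
  -- `S = Σ d_k² |x_k|²`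
  have hSx : S = ∑ k, Real.exp (θ * dist k j₀) ^ 2 * ‖x k‖ ^ 2 := by
    refine Finset.sum_congr rfl fun k _ => ?_
    rw [hv]
    dsimp only
    rw [norm_mul, Complex.norm_real, Real.norm_eq_abs, abs_of_pos (Real.exp_pos _), mul_pow]
  -- (1) the algebra: `y⋆ · (K x) = (a + em)⋆ · (a + ep) + μ S`
  have hpl : ∀ l, (a + ep) l = (d l : ℂ) * (A *ᵥ x) l := by
    intro l
    simp only [ha, hep, hEp, hv, Pi.add_apply, Matrix.mulVec, dotProduct, Matrix.of_apply]
    rw [← Finset.sum_add_distrib, Finset.mul_sum]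
    refine Finset.sum_congr rfl fun k _ => ?_
    have hc : Real.exp (θ * ((dist l j₀ : ℝ) - dist k j₀)) * d k = d l := by
      simp only [hd]; rw [← Real.exp_add]; ring_nf
    have hc' : ((Real.exp (θ * ((dist l j₀ : ℝ) - dist k j₀)) : ℝ) : ℂ) * (d k : ℂ) =
        (d l : ℂ) := by exact_mod_cast hc
    simp only [Complex.ofReal_sub, Complex.ofReal_one]
    linear_combination (A l k * x k) * hc'
  have hml : ∀ l, (d l : ℂ) * (a + em) l = (A *ᵥ y) l := by
    intro l
    simp only [ha, hem, hEm, hv, hy, Pi.add_apply, Matrix.mulVec, dotProduct, Matrix.of_apply]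
    rw [← Finset.sum_add_distrib, Finset.mul_sum]
    refine Finset.sum_congr rfl fun k _ => ?_
    have hc : Real.exp (θ * ((dist k j₀ : ℝ) - dist l j₀)) * d l = d k := by
      simp only [hd]; rw [← Real.exp_add]; ring_nf
    have hc' : ((Real.exp (θ * ((dist k j₀ : ℝ) - dist l j₀)) : ℝ) : ℂ) * (d l : ℂ) =
        (d k : ℂ) := by exact_mod_cast hc
    simp only [Complex.ofReal_sub, Complex.ofReal_one, Complex.ofReal_pow]
    linear_combination (A l k * x k * d k) * hc'
  have hAyAx : star (A *ᵥ y) ⬝ᵥ (A *ᵥ x) = star (a + em) ⬝ᵥ (a + ep) := by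
    simp only [dotProduct, Pi.star_apply]
    refine Finset.sum_congr rfl fun l _ => ?_
    rw [← hml l, hpl l, star_mul', Complex.star_def, Complex.conj_ofReal]
    ring
  have hyx : star y ⬝ᵥ x = (S : ℂ) := by
    rw [hS, Complex.ofReal_sum]
    simp only [dotProduct, Pi.star_apply, hy, hv, star_mul', Complex.star_def,
      Complex.conj_ofReal]
    refine Finset.sum_congr rfl fun k _ => ?_
    rw [norm_mul, mul_pow, Complex.norm_real, Real.norm_eq_abs, sq_abs]
    push_cast
    rw [← Complex.conj_mul']
    ring
  have hK : star y ⬝ᵥ ((Aᴴ * A + (μ : ℂ) • (1 : Matrix ι ι ℂ)) *ᵥ x) =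
      star (a + em) ⬝ᵥ (a + ep) + (μ : ℂ) * S := by
    rw [Matrix.add_mulVec, Matrix.smul_mulVec, Matrix.one_mulVec, ← Matrix.mulVec_mulVec,
      dotProduct_add, dotProduct_smul, smul_eq_mul, hyx, Matrix.dotProduct_mulVec,
      ← Matrix.star_mulVec, hAyAx]
  -- (2) the perturbations are `η`-small (Schur's test)
  have hEp_le : ∀ l k, ‖Ep l k‖ ≤ (Real.exp θ - 1) * (if dist l k ≠ 0 then ‖A l k‖ else 0) := by
    intro l k
    simp only [hEp, Matrix.of_apply]
    exact norm_mul_exp_sub_one_le dist A hrange hθ l k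
      (abs_natDist_sub_natDist_le dist hds hdt l k j₀)
  have hEm_le : ∀ l k, ‖Em l k‖ ≤ (Real.exp θ - 1) * (if dist l k ≠ 0 then ‖A l k‖ else 0) := by
    intro l k
    simp only [hEm, Matrix.of_apply]
    refine norm_mul_exp_sub_one_le dist A hrange hθ l k ?_
    rw [abs_sub_comm]
    exact abs_natDist_sub_natDist_le dist hds hdt l k j₀
  have hsum : ∀ (f g : ι → ℝ) (nz : ι → Prop) [DecidablePred nz],
      (∀ k, f k ≤ (Real.exp θ - 1) * (if nz k then g k else 0)) →
        ∑ k ∈ univ.filter nz, g k ≤ h → ∑ k, f k ≤ η := by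
    intro f g nz _ hf hb
    calc ∑ k, f k ≤ ∑ k, (Real.exp θ - 1) * (if nz k then g k else 0) := sum_le_sum fun k _ => hf k
      _ = (Real.exp θ - 1) * ∑ k ∈ univ.filter nz, g k := by rw [← mul_sum, sum_filter]
      _ ≤ η := by rw [hη, mul_comm h]; exact mul_le_mul_of_nonneg_left hb hexp0
  have hSchur : ∀ E : Matrix ι ι ℂ,
      (∀ l k, ‖E l k‖ ≤ (Real.exp θ - 1) * (if dist l k ≠ 0 then ‖A l k‖ else 0)) →
        ∑ l, ‖(E *ᵥ v) l‖ ^ 2 ≤ η ^ 2 * S := fun E hE => by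
    simpa only [← pow_two] using sum_norm_sq_mulVec_le_of_rowSum_le_of_colSum_le E hη0
      (fun l => hsum _ _ _ (fun k => hE l k) (hrow l))
      (fun k => hsum _ _ _ (fun l => hE l k) (hcol k)) v
  have hSp : ∑ l, ‖ep l‖ ^ 2 ≤ η ^ 2 * S := hSchur Ep hEp_le
  have hSm : ∑ l, ‖em l‖ ^ 2 ≤ η ^ 2 * S := hSchur Em hEm_le
  -- (3) the coercivity estimate
  rw [← hSx]
  have hre : (star y ⬝ᵥ ((Aᴴ * A + (μ : ℂ) • (1 : Matrix ι ι ℂ)) *ᵥ x)).re =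
      (star (a + em) ⬝ᵥ (a + ep)).re + μ * S := by
    rw [hK, Complex.add_re, Complex.re_ofReal_mul, Complex.ofReal_re]
  rw [hre]
  by_cases hS00 : S = 0
  · -- then `v = 0` and everything vanishes
    have hv0 : v = 0 := funext fun k => by
      have := (sum_eq_zero_iff_of_nonneg fun k _ => sq_nonneg ‖v k‖).mp hS00 k (mem_univ k)
      exact norm_eq_zero.mp (pow_eq_zero_iff two_ne_zero |>.mp this)
    simp [hS00, ha, hep, hem, hv0]
  have hSpos : 0 < S := lt_of_le_of_ne hS0 (Ne.symm hS00)
  -- norms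
  set Na : ℝ := Real.sqrt (∑ l, ‖a l‖ ^ 2) with hNa
  set Nv : ℝ := Real.sqrt S with hNv
  set Np : ℝ := Real.sqrt (∑ l, ‖ep l‖ ^ 2) with hNp
  set Nm : ℝ := Real.sqrt (∑ l, ‖em l‖ ^ 2) with hNm
  have hNa0 : 0 ≤ Na := Real.sqrt_nonneg _
  have hNv0 : 0 < Nv := Real.sqrt_pos.mpr hSpos
  have hNvsq : Nv ^ 2 = S := Real.sq_sqrt hS0
  have hNasq : Na ^ 2 = ∑ l, ‖a l‖ ^ 2 := Real.sq_sqrt (Finset.sum_nonneg fun l _ => by positivity)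
  have hsq : Real.sqrt (η ^ 2 * S) = η * Nv := by rw [Real.sqrt_mul (sq_nonneg η), Real.sqrt_sq hη0]
  have hNp_le : Np ≤ η * Nv := hsq ▸ Real.sqrt_le_sqrt hSp
  have hNm_le : Nm ≤ η * Nv := hsq ▸ Real.sqrt_le_sqrt hSm
  have hNp0 : 0 ≤ Np := Real.sqrt_nonneg _
  have hNm0 : 0 ≤ Nm := Real.sqrt_nonneg _
  -- the floor: `√F ≤ Na / Nv`
  have ht : Real.sqrt F ≤ Na / Nv := by
    rw [le_div_iff₀ hNv0]
    calc Real.sqrt F * Nv = Real.sqrt (F * S) := by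
          rw [Real.sqrt_mul' F hS0]
      _ ≤ Na := Real.sqrt_le_sqrt (hfloor v)
  have hc2 : γ * S ≤ Na ^ 2 - 2 * η * Na * Nv - η ^ 2 * S + μ * S := by
    have h1 : γ * Nv ^ 2 ≤ ((Na / Nv) ^ 2 - 2 * η * (Na / Nv) - η ^ 2 + μ) * Nv ^ 2 :=
      mul_le_mul_of_nonneg_right (hcoer (Na / Nv) ht) (sq_nonneg _)
    have h2 : ((Na / Nv) ^ 2 - 2 * η * (Na / Nv) - η ^ 2 + μ) * Nv ^ 2 =
        Na ^ 2 - 2 * η * Na * Nv - η ^ 2 * Nv ^ 2 + μ * Nv ^ 2 := by field_simp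
    rwa [h2, hNvsq] at h1
  -- expand the sesquilinear form
  have hexpand : (star (a + em) ⬝ᵥ (a + ep)).re =
      (star a ⬝ᵥ a).re + (star a ⬝ᵥ ep).re + (star em ⬝ᵥ a).re + (star em ⬝ᵥ ep).re := by
    rw [star_add, add_dotProduct, dotProduct_add, dotProduct_add]
    simp only [Complex.add_re]
    ring
  have haa : (star a ⬝ᵥ a).re = Na ^ 2 := by
    rw [hNasq]
    simp only [dotProduct, Pi.star_apply, Complex.re_sum, Complex.star_def, Complex.conj_mul']
    refine Finset.sum_congr rfl fun l _ => ?_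
    norm_cast
  have hcs : ∀ u w : ι → ℂ, -(Real.sqrt (∑ l, ‖u l‖ ^ 2) * Real.sqrt (∑ l, ‖w l‖ ^ 2)) ≤
      (star u ⬝ᵥ w).re := fun u w =>
    (abs_le.mp ((Complex.abs_re_le_norm _).trans (norm_star_dotProduct_le_sqrt_mul_sqrt u w))).1
  have hcs1 := hcs a ep
  have hcs2 := hcs em a
  have hcs3 := hcs em ep
  have hb1 : Na * Np ≤ η * Na * Nv := by nlinarith
  have hb2 : Nm * Na ≤ η * Na * Nv := by nlinarith
  have hb3 : Nm * Np ≤ η ^ 2 * S := by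
    calc Nm * Np ≤ (η * Nv) * (η * Nv) := mul_le_mul hNm_le hNp_le hNp0 (by positivity)
      _ = η ^ 2 * S := by rw [← hNvsq]; ring
  rw [hexpand, haa]
  linarith

/-- **The quadratic Combes–Thomas bound** (Combes–Thomas 1973; Aizenman–Warzel §10.3, in the
sandwich form for `AᴴA`).  Let `dist` be an `ℕ`-valued pseudo-metric on the finite index set `ι`
and `A : Matrix ι ι ℂ` a range-one matrix (`A i j ≠ 0 → dist i j ≤ 1`) whose absolute row and
column sums over `{dist ≠ 0}` are at most `h`; let `F Σ|v_i|² ≤ Σ|(Av)_i|²` for all `v`, let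
`θ ≥ 0`, `γ > 0`, `μ ∈ ℝ`, `η := h(e^θ − 1)`, and assume `γ ≤ t² − 2ηt − η² + μ` for all
`t ≥ √F`.  Then `AᴴA + μ` is invertible and
`|(AᴴA + μ)⁻¹ᵢⱼ| ≤ γ⁻¹ e^{−θ dist(i,j)}` for all `i, j`.  (Typical uses: `F = 0`, `μ = λ > 0`,
`η = √λ/2`, `γ = λ/2` — the `λ`-uniform locality of `(DᴴD + λ)⁻¹`; or `F > 0`, `μ = −e` with
`e < F` — Agmon decay below the floor.) [folklore] -/
theorem quadratic_combes_thomas (dist : ι → ι → ℕ) (hd0 : ∀ i, dist i i = 0)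
    (hds : ∀ i j, dist i j = dist j i) (hdt : ∀ i j k, dist i k ≤ dist i j + dist j k)
    (A : Matrix ι ι ℂ) (hrange : ∀ i j, A i j ≠ 0 → dist i j ≤ 1) (h : ℝ)
    (hrow : ∀ i, ∑ j ∈ univ.filter (fun j => dist i j ≠ 0), ‖A i j‖ ≤ h)
    (hcol : ∀ j, ∑ i ∈ univ.filter (fun i => dist i j ≠ 0), ‖A i j‖ ≤ h)
    (F μ θ γ : ℝ) (hθ : 0 ≤ θ) (hγ : 0 < γ)
    (hfloor : ∀ v : ι → ℂ, F * ∑ i, ‖v i‖ ^ 2 ≤ ∑ i, ‖(A *ᵥ v) i‖ ^ 2)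
    (hcoer : ∀ t : ℝ, Real.sqrt F ≤ t →
      γ ≤ t ^ 2 - 2 * (h * (Real.exp θ - 1)) * t - (h * (Real.exp θ - 1)) ^ 2 + μ) :
    IsUnit (Aᴴ * A + (μ : ℂ) • (1 : Matrix ι ι ℂ)).det ∧
      ∀ i j, ‖(Aᴴ * A + (μ : ℂ) • (1 : Matrix ι ι ℂ))⁻¹ i j‖ ≤
        1 / γ * Real.exp (-(θ * dist i j)) := by
  set K : Matrix ι ι ℂ := Aᴴ * A + (μ : ℂ) • (1 : Matrix ι ι ℂ) with hK
  have core : ∀ (j₀ : ι) (x : ι → ℂ), γ * ∑ k, Real.exp (θ * dist k j₀) ^ 2 * ‖x k‖ ^ 2 ≤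
      (star (fun k => ((Real.exp (θ * dist k j₀) ^ 2 : ℝ) : ℂ) * x k) ⬝ᵥ (K *ᵥ x)).re :=
    fun j₀ x => quadraticCombesThomas_weighted_coercive dist hds hdt A hrange h hrow hcol F μ θ γ
      hθ hfloor hcoer j₀ x
  -- the diagonal weight is `1` and dominates: `|x_{j₀}|² ≤ Σ_k d_k² |x_k|²`
  have hdiag : ∀ (j₀ : ι) (x : ι → ℂ),
      ‖x j₀‖ ^ 2 ≤ ∑ k, Real.exp (θ * dist k j₀) ^ 2 * ‖x k‖ ^ 2 := by
    intro j₀ x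
    have := Finset.single_le_sum (f := fun k => Real.exp (θ * dist k j₀) ^ 2 * ‖x k‖ ^ 2)
      (fun k _ => by positivity) (Finset.mem_univ j₀)
    simpa only [hd0, Nat.cast_zero, mul_zero, Real.exp_zero, one_pow, one_mul] using this
  -- (1) `K` is injective, hence invertible
  have hdet : IsUnit K.det := by
    rw [isUnit_iff_ne_zero, Ne, ← Matrix.exists_mulVec_eq_zero_iff]
    rintro ⟨x, hx, hKx⟩
    obtain ⟨j₀, hj₀⟩ := Function.ne_iff.mp hx
    have h1 := core j₀ x
    rw [hKx, dotProduct_zero, Complex.zero_re] at h1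
    have h2 := hdiag j₀ x
    have h3 : 0 < ‖x j₀‖ ^ 2 := by positivity
    nlinarith
  refine ⟨hdet, fun i j => ?_⟩
  -- (2) the column `j` of `K⁻¹`
  obtain ⟨x, hx⟩ : ∃ x : ι → ℂ, x = K⁻¹ *ᵥ Pi.single j 1 := ⟨_, rfl⟩
  have hxK : ∀ k, x k = K⁻¹ k j := fun k => by
    rw [hx, Matrix.mulVec_single_one, Matrix.col_apply]
  have hKx : K *ᵥ x = Pi.single j 1 := by
    rw [hx, Matrix.mulVec_mulVec, Matrix.mul_nonsing_inv _ hdet, Matrix.one_mulVec]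
  rw [← hxK i]
  obtain ⟨S, hS⟩ : ∃ S : ℝ, S = ∑ k, Real.exp (θ * dist k j) ^ 2 * ‖x k‖ ^ 2 := ⟨_, rfl⟩
  have h1 := core j x
  rw [hKx, dotProduct_single_one, ← hS] at h1
  simp only [Pi.star_apply, hd0, Nat.cast_zero, mul_zero, Real.exp_zero, one_pow,
    Complex.ofReal_one, one_mul, Complex.star_def, Complex.conj_re] at h1
  have hS0 : 0 ≤ S := by rw [hS]; exact Finset.sum_nonneg fun k _ => by positivity
  have hjS : ‖x j‖ ^ 2 ≤ S := by rw [hS]; exact hdiag j x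
  have hiS : Real.exp (θ * dist i j) ^ 2 * ‖x i‖ ^ 2 ≤ S := by
    rw [hS]
    exact Finset.single_le_sum (f := fun k => Real.exp (θ * dist k j) ^ 2 * ‖x k‖ ^ 2)
      (fun k _ => by positivity) (Finset.mem_univ i)
  -- `γ S ≤ Re x_j ≤ |x_j| ≤ √S`, hence `γ² S ≤ 1`
  have h2 : γ * S ≤ ‖x j‖ := h1.trans (Complex.re_le_norm _)
  have hγS : 0 ≤ γ * S := mul_nonneg hγ.le hS0
  have h3 : (γ * S) ^ 2 ≤ S := (pow_le_pow_left₀ hγS h2 2).trans hjS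
  have h4 : (Real.exp (θ * dist i j) * ‖x i‖) ^ 2 ≤ (1 / γ) ^ 2 := by
    rw [mul_pow]
    refine hiS.trans ?_
    by_cases hS00 : S = 0
    · rw [hS00]; positivity
    · have hSpos : 0 < S := lt_of_le_of_ne hS0 (Ne.symm hS00)
      have h5 : γ ^ 2 * S ≤ 1 := by
        have h6 : γ ^ 2 * S * S ≤ 1 * S := by nlinarith
        exact le_of_mul_le_mul_right h6 hSpos
      rw [div_pow, one_pow, le_div_iff₀ (by positivity)]
      linarith
  have h5 : Real.exp (θ * dist i j) * ‖x i‖ ≤ 1 / γ :=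
    (pow_le_pow_iff_left₀ (by positivity) (by positivity) two_ne_zero).mp h4
  rw [Real.exp_neg, ← div_eq_mul_inv, le_div_iff₀ (Real.exp_pos _), mul_comm]
  exact h5

end CombesThomas

end Literature.Analysis.Matrix
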